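import Summits.Ventures.Crystal3D.Theorems.StickyWulffConstantTextureBuildHealExchange
import HarnessLib

/-!
# TB-1 brick L-HEAL, cut form: healing ANY junk costs at most half the ABANDONED ADJACENCIES of the cut, minus the junk's own half-defects (kissing bound)
# (lane T, crux `TextureLiminfV5`, stmt-Ventures-23912; memo HOME/wulff-p2/g24/HEAL-g24.md §2–§3: the needle-forest tripwire and why aggressive healing answers it)

HONEST FRAMING. Venture `Summits/Ventures/Crystal3D` (cell `crystal3d-full`), route `route-Ventures-StickyWulffConstant`, helper `--supports` the
law-v5 crux `TextureLiminfV5` (stmt-Ventures-23912).  Pure finite combinatorics over '…TextureBuildHealExchange' (census-free, standard axioms).  Nothing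
about any cover or texture is claimed; F-C1 not moved.

WHY.  The local criteria of '…HealExchange' (junk of degree `≤ 6`, refilled sites with `2k + j ≥ 12`) do not cover DENSE junk (amorphous blobs, thin
misoriented micrograins, needles of degree `≥ 7`) attached to a wall — and a summable «needle forest» of such features at all heights (memo §2: density
`∝ θ''²/H²`, total cost `O(θ''²)·A`, `N`-independent) defeats every swallow-or-grade wall-cell pattern.  The answer is that healing needs NO hypothesis on the
junk at all: by the KISSING BOUND at every kept lattice ball `b`, the removed junk touching `b` is at most the vacant lattice sites around `b`, i.e. at most
the refilled sites touching `b` plus the ABANDONED ones.  Hence, exactly: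

* `abandoned S K V p` — the touching `S`-sites of `p` that are neither kept balls nor refilled (the vacant sites the surgery leaves next to `p`);
* `sum_refill_le` — the refill terms of the exchange identity are `≤ ½·Σ_{v ∈ V} #abandoned(v) − ½·cross(K, V)` (twelve touching sites per refilled site);
* `crossCount_removed_le` — **kissing**: `cross(K, R) ≤ cross(K, V) + Σ_{b ∈ K touching R} #abandoned(b)` when the kept balls touching removed junk lie on `S`;
* **`contactDeficiency_cut_heal_le`** — for a packing `X`, `R ⊆ X`, `V` a set of `S`-sites disjoint from `K := X ∖ R`, kept balls touching `R` on `S`: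
  `D(K ∪ V) ≤ D(X) − Σ_{a ∈ R} halfDefect_X a + ½·(Σ_{v ∈ V} #abandoned(v) + Σ_{b ∈ K touching R} #abandoned(b))`
  — ANY junk heals at a gain of its own half-defects, paying only for the cut; with a clean cut (no abandoned adjacency) `D(K ∪ V) ≤ D(X) − hd_X(R)`
  (`contactDeficiency_cut_heal_le_of_clean`, the quantitative form of '…Heal's `contactDeficiency_heal_le`, now without any full-coordination bookkeeping).
The count side (amorphous junk is `≤ #D = O(Def)` balls; crystalline off-lattice material needs lattice-point counting) and the labelled/selection forms are
the sequel; see the memo.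
-/

noncomputable section

namespace Summit.Ventures.Crystal3D.Theorems

open Finset Summit.Ventures.Crystal3D
open Literature.MathematicalPhysics.StatisticalMechanics (IsHaggSeq contactDeficiency)
open Summit.Ventures.Crystal3D.Cruxes.TextureLiminf.TexShadow (E3 stacking one_le_dist_of_mem_stacking)

section Cut

variable {L : E3 ≃ₗᵢ[ℝ] E3} {s : E3} {σ : ℤ → ℤ}

/-- The ABANDONED adjacencies of the point `p` under the surgery with kept balls `K` and refilled sites `V`: the touching `S`-sites of `p` that are neither
kept balls nor refilled. -/
def abandoned (S : Set E3) (K V : Finset E3) (p : E3) : ℕ :=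
  {w | w ∈ S ∧ dist p w = 1 ∧ w ∉ K ∧ w ∉ V}.ncard

/-- Twelve touching sites: at a site `p` of a moved Barlow stacking, `12 ≤ cdeg_K p + cdeg_V p + #abandoned(p)`. -/
theorem twelve_le_cdeg_add_cdeg_add_abandoned (hσ : IsHaggSeq σ) {p : E3} (hp : p ∈ stacking L s σ) (K V : Finset E3) :
    12 ≤ cdeg K p + cdeg V p + abandoned (stacking L s σ) K V p := by
  classical
  have hT12 : {w | w ∈ stacking L s σ ∧ dist p w = 1}.ncard = 12 := ncard_touching_stacking_eq_twelve hσ hp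
  have hTfin : {w | w ∈ stacking L s σ ∧ dist p w = 1}.Finite := Set.finite_of_ncard_pos (by rw [hT12]; norm_num)
  have hsub : {w | w ∈ stacking L s σ ∧ dist p w = 1} ⊆
      ((↑(K.filter fun q => dist p q = 1) ∪ ↑(V.filter fun q => dist p q = 1)) ∪
        {w | w ∈ stacking L s σ ∧ dist p w = 1 ∧ w ∉ K ∧ w ∉ V} : Set E3) := by
    rintro w ⟨hwS, hwd⟩
    by_cases hwK : w ∈ K
    · exact Set.mem_union_left _ (Set.mem_union_left _ (Finset.mem_coe.2 (Finset.mem_filter.2 ⟨hwK, hwd⟩)))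
    · by_cases hwV : w ∈ V
      · exact Set.mem_union_left _ (Set.mem_union_right _ (Finset.mem_coe.2 (Finset.mem_filter.2 ⟨hwV, hwd⟩)))
      · exact Set.mem_union_right _ ⟨hwS, hwd, hwK, hwV⟩
  have hfinU : ((↑(K.filter fun q => dist p q = 1) ∪ ↑(V.filter fun q => dist p q = 1)) ∪
      {w | w ∈ stacking L s σ ∧ dist p w = 1 ∧ w ∉ K ∧ w ∉ V} : Set E3).Finite :=
    ((Finset.finite_toSet _).union (Finset.finite_toSet _)).union (hTfin.subset fun w hw => ⟨hw.1, hw.2.1⟩)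
  have h1 := Set.ncard_le_ncard hsub hfinU
  have h2 := Set.ncard_union_le (↑(K.filter fun q => dist p q = 1) ∪ ↑(V.filter fun q => dist p q = 1) : Set E3)
    {w | w ∈ stacking L s σ ∧ dist p w = 1 ∧ w ∉ K ∧ w ∉ V}
  have h3 := Set.ncard_union_le (↑(K.filter fun q => dist p q = 1) : Set E3) (↑(V.filter fun q => dist p q = 1) : Set E3)
  rw [Set.ncard_coe_finset, Set.ncard_coe_finset] at h3
  rw [hT12] at h1
  unfold cdeg abandoned
  omega

variable {X R V : Finset E3}

/-- **Refill terms**: for refilled SITES `V ⊆ S`, `Σ_{v ∈ V} (6 − cdeg_K v − ½·cdeg_V v) ≤ ½·Σ_{v ∈ V} #abandoned(v) − ½·cross(K, V)`. -/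
theorem sum_refill_le (hσ : IsHaggSeq σ) (K : Finset E3) (hVS : ∀ v ∈ V, v ∈ stacking L s σ) :
    ∑ v ∈ V, ((6 : ℝ) - (cdeg K v : ℝ) - (cdeg V v : ℝ) / 2) ≤
      (∑ v ∈ V, (abandoned (stacking L s σ) K V v : ℝ)) / 2 - (crossCount K V : ℝ) / 2 := by
  rw [crossCount_comm, crossCount_eq_sum, Nat.cast_sum, Finset.sum_div, Finset.sum_div, ← Finset.sum_sub_distrib]
  refine Finset.sum_le_sum fun v hv => ?_
  have h12 : (12 : ℝ) ≤ (cdeg K v : ℝ) + (cdeg V v : ℝ) + (abandoned (stacking L s σ) K V v : ℝ) := by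
    exact_mod_cast twelve_le_cdeg_add_cdeg_add_abandoned hσ (hVS v hv) K V
  have hK : (((K.filter fun q => dist v q = 1).card : ℕ) : ℝ) = (cdeg K v : ℝ) := rfl
  rw [hK]
  linarith

/-- **KISSING BOUND ON THE REMOVED JUNK**: if `X` is a packing, `R ⊆ X`, `K = X ∖ R`, and every kept ball touching a removed ball lies on `S`, then
`cross(K, R) ≤ cross(K, V) + Σ_{b ∈ K touching R} #abandoned(b)` — at each such `b` the removed contacts are at most `12 − cdeg_K b`, which is at most the
refilled plus the abandoned touching sites of `b`. -/
theorem crossCount_removed_le (hσ : IsHaggSeq σ) (hX : ∀ p ∈ X, ∀ q ∈ X, p ≠ q → 1 ≤ dist p q) (hR : R ⊆ X) (V : Finset E3)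
    (hK : ∀ b ∈ X \ R, (∃ a ∈ R, dist b a = 1) → b ∈ stacking L s σ) :
    (crossCount (X \ R) R : ℝ) ≤ (crossCount (X \ R) V : ℝ) +
      ∑ b ∈ (X \ R).filter (fun b => ∃ a ∈ R, dist b a = 1), (abandoned (stacking L s σ) (X \ R) V b : ℝ) := by
  classical
  set K : Finset E3 := X \ R with hKdef
  rw [crossCount_eq_sum, crossCount_eq_sum, Nat.cast_sum, Nat.cast_sum]
  -- split the sum over `K` into balls touching `R` and the others (whose term vanishes)
  have hsplit : ∀ b ∈ K, (((R.filter fun q => dist b q = 1).card : ℕ) : ℝ) ≤ (((V.filter fun q => dist b q = 1).card : ℕ) : ℝ) +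
      (if (∃ a ∈ R, dist b a = 1) then (abandoned (stacking L s σ) K V b : ℝ) else 0) := by
    intro b hb
    by_cases htouch : ∃ a ∈ R, dist b a = 1
    · rw [if_pos htouch]
      have hbS := hK b hb htouch
      -- kissing at `b`: `cdeg_K b + cdeg_R b = cdeg_X b ≤ 12`
      have hKX : K ⊆ X := Finset.sdiff_subset
      have hXK : X \ K = R := by rw [hKdef, Finset.sdiff_sdiff_eq_self hR]
      have hdeg : cdeg X b = cdeg K b + cdeg R b := by
        have := cdeg_eq_add_sdiff hKX b; rw [hXK] at this; exact this
      have h12X := cdeg_le_twelve X hX b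
      have h12S := twelve_le_cdeg_add_cdeg_add_abandoned hσ hbS K V
      have hRb : (((R.filter fun q => dist b q = 1).card : ℕ) : ℝ) = (cdeg R b : ℝ) := rfl
      have hVb : (((V.filter fun q => dist b q = 1).card : ℕ) : ℝ) = (cdeg V b : ℝ) := rfl
      rw [hRb, hVb]
      have : cdeg R b ≤ cdeg V b + abandoned (stacking L s σ) K V b := by omega
      exact_mod_cast this
    · rw [if_neg htouch, add_zero]
      have h0 : (R.filter fun q => dist b q = 1).card = 0 := by
        rw [Finset.card_eq_zero, Finset.filter_eq_empty_iff]
        intro a ha hd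
        exact htouch ⟨a, ha, hd⟩
      rw [h0]
      exact_mod_cast Nat.zero_le _
  have hsum := Finset.sum_le_sum hsplit
  rw [Finset.sum_add_distrib, ← Finset.sum_filter] at hsum
  exact hsum

/-- **CUT HEAL**: healing ANY junk `R` by refilling lattice sites `V` (disjoint from the kept balls `K = X ∖ R`, kept balls touching `R` on the lattice) satisfies
`D(K ∪ V) ≤ D(X) − Σ_{a ∈ R} halfDefect_X a + ½·(Σ_{v ∈ V} #abandoned(v) + Σ_{b ∈ K touching R} #abandoned(b))`. -/
theorem contactDeficiency_cut_heal_le (hσ : IsHaggSeq σ) (hX : ∀ p ∈ X, ∀ q ∈ X, p ≠ q → 1 ≤ dist p q) (hR : R ⊆ X)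
    (hV : Disjoint V (X \ R)) (hVS : ∀ v ∈ V, v ∈ stacking L s σ)
    (hK : ∀ b ∈ X \ R, (∃ a ∈ R, dist b a = 1) → b ∈ stacking L s σ) :
    contactDeficiency ((X \ R) ∪ V) ≤ contactDeficiency X - ∑ a ∈ R, halfDefect X a +
      ((∑ v ∈ V, (abandoned (stacking L s σ) (X \ R) V v : ℝ)) +
        ∑ b ∈ (X \ R).filter (fun b => ∃ a ∈ R, dist b a = 1), (abandoned (stacking L s σ) (X \ R) V b : ℝ)) / 2 := by
  classical
  rw [contactDeficiency_exchange_eq hR hV]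
  -- removal terms: `cdeg_X a − ½·cdeg_R a − 6 = ½·cdeg_K a − halfDefect_X a`
  have hKX : X \ R ⊆ X := Finset.sdiff_subset
  have hXK : X \ (X \ R) = R := Finset.sdiff_sdiff_eq_self hR
  have hrem : ∑ a ∈ R, ((cdeg X a : ℝ) - (cdeg R a : ℝ) / 2 - 6) =
      (crossCount (X \ R) R : ℝ) / 2 - ∑ a ∈ R, halfDefect X a := by
    rw [crossCount_comm, crossCount_eq_sum, Nat.cast_sum, Finset.sum_div, ← Finset.sum_sub_distrib]
    refine Finset.sum_congr rfl fun a _ => ?_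
    have hdeg : (cdeg X a : ℝ) = (cdeg (X \ R) a : ℝ) + (cdeg R a : ℝ) := by
      have := cdeg_eq_add_sdiff hKX a; rw [hXK] at this; exact_mod_cast this
    have hKa : (((X \ R).filter fun q => dist a q = 1).card : ℕ) = cdeg (X \ R) a := rfl
    rw [hKa]
    unfold halfDefect
    rw [hdeg]; ring
  have hrefill := sum_refill_le hσ (X \ R) hVS (V := V)
  have hkiss := crossCount_removed_le hσ hX hR V hK
  rw [hrem]
  linarith

/-- **Clean cut**: with no abandoned adjacency at the refilled sites and at the kept balls touching the junk, `D(K ∪ V) ≤ D(X) − Σ_{a ∈ R} halfDefect_X a`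
— the junk's own half-defects are GAINED, whatever the junk is. -/
theorem contactDeficiency_cut_heal_le_of_clean (hσ : IsHaggSeq σ) (hX : ∀ p ∈ X, ∀ q ∈ X, p ≠ q → 1 ≤ dist p q) (hR : R ⊆ X)
    (hV : Disjoint V (X \ R)) (hVS : ∀ v ∈ V, v ∈ stacking L s σ)
    (hK : ∀ b ∈ X \ R, (∃ a ∈ R, dist b a = 1) → b ∈ stacking L s σ)
    (hcleanV : ∀ v ∈ V, abandoned (stacking L s σ) (X \ R) V v = 0)
    (hcleanK : ∀ b ∈ X \ R, (∃ a ∈ R, dist b a = 1) → abandoned (stacking L s σ) (X \ R) V b = 0) :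
    contactDeficiency ((X \ R) ∪ V) ≤ contactDeficiency X - ∑ a ∈ R, halfDefect X a := by
  classical
  have h := contactDeficiency_cut_heal_le hσ hX hR hV hVS hK
  have h1 : ∑ v ∈ V, (abandoned (stacking L s σ) (X \ R) V v : ℝ) = 0 :=
    Finset.sum_eq_zero fun v hv => by rw [hcleanV v hv]; exact Nat.cast_zero
  have h2 : ∑ b ∈ (X \ R).filter (fun b => ∃ a ∈ R, dist b a = 1), (abandoned (stacking L s σ) (X \ R) V b : ℝ) = 0 :=
    Finset.sum_eq_zero fun b hb => by
      obtain ⟨hbK, htouch⟩ := Finset.mem_filter.1 hb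
      rw [hcleanK b hbK htouch]; exact Nat.cast_zero
  rw [h1, h2, add_zero, zero_div, add_zero] at h
  exact h

/-- The half-defects of a packing's balls are nonnegative, so a clean cut heal never raises the deficiency. -/
theorem contactDeficiency_cut_heal_le_self_of_clean (hσ : IsHaggSeq σ) (hX : ∀ p ∈ X, ∀ q ∈ X, p ≠ q → 1 ≤ dist p q) (hR : R ⊆ X)
    (hV : Disjoint V (X \ R)) (hVS : ∀ v ∈ V, v ∈ stacking L s σ)
    (hK : ∀ b ∈ X \ R, (∃ a ∈ R, dist b a = 1) → b ∈ stacking L s σ)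
    (hcleanV : ∀ v ∈ V, abandoned (stacking L s σ) (X \ R) V v = 0)
    (hcleanK : ∀ b ∈ X \ R, (∃ a ∈ R, dist b a = 1) → abandoned (stacking L s σ) (X \ R) V b = 0) :
    contactDeficiency ((X \ R) ∪ V) ≤ contactDeficiency X := by
  have h := contactDeficiency_cut_heal_le_of_clean hσ hX hR hV hVS hK hcleanV hcleanK
  have h0 : 0 ≤ ∑ a ∈ R, halfDefect X a := Finset.sum_nonneg fun a _ => halfDefect_nonneg X hX a
  linarith

end Cut

end Summit.Ventures.Crystal3D.Theorems

end
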